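import Summits.QuantumFields.BalabanUV.Beta.CovariantTowerParametrix

/-!
# Beta / CovariantTowerLocality — THE OUTPUT SUPPORT OF THE PARAMETRIX REMAINDER TERMS: Ω₀(z)·K(h_z) = K(h_z) for the
# k-fold covariant tower operator (pv21 MODEL) with the b05 partition of unity and the block-hull regions Ω₀(z); hence
# THM 3.7-SHAPE IN ℓ² for the tower with ONE counting number of the cover as the only hypothesis beyond the data
# (unit `b2b-balaban-beta-d4-p2`, GEN 4; node (m1) of `beta/skeletons/D4-NODE-O2-b2b-balaban-beta-d4-p2.md`, geometric
# half, part 1; imports `CovariantTowerParametrix` only)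

HONEST FRAMING: discharging `BetaPertH` makes Bałaban's UV stability UNCONDITIONAL — NOT the continuum limit, NOT the
Clay problem.  HONEST DEPENDENCY (verbatim): «continuum YM on T⁴ ⇐ BetaPertH ∧ nine spine estimates (0/9 proved);
BetaPertH ⇐ (D1) ∧ (D4) ∧ CAP+tail; G-an2-4 gates asym, D1 and NE2/3/4.»  THIS MODULE DISCHARGES NOTHING of `BetaPertH`,
asserts NOTHING printed and cites nothing as a fact (ABSOLUTE RULE): [folklore] kernel theorems about the component MODEL of
the pv21 chain ([B9] = `Balaban1985BackgroundPropagators`, Commun. Math. Phys. 99 (1985) 389–434; SHAPES: K(h) of (3.88) and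
«the operators K(h_□)G′_□h_□ … are localized» behind (3.89), p. 409; Thm 3.7).

CONTENT.
* §1 generic: `mulOp_comp_leibRemT_of_support`, `mulOp_comp_covDT_leibRem_of_support` — the two Leibniz parts of K(h)
  write only where ∂h lives (a {0,1}-region χ with χ = 1 at both ends of every bond carrying c(b)(h(b₊) − h(b₋)) ≠ 0).
* §2 torus: `omegaBall_of_dh_ne` (a bond along which h_z changes has both ends in Ω₀(z) — `near_ctr_of_dh_ne` +
  `omegaBall_eq_one`), **`mulOp_omegaBall_mul_towerK`**: M_{Ω₀(z)}·K(h_z) = K(h_z) (Leibniz parts by §1; the commutator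
  part because Ω₀(z)h_z = h_z and the level sum COMMUTES with M_{Ω₀(z)}, Ω₀(z) being constant on the level-k blocks —
  pv21 `towerLevelSum_comm_mulOp`), `remainderTerm_support` (K(h_z)G′_zh_z writes only Ω₀(z)), `chiBall_le_omegaBall`.
* §3 **`parametrix_l2_tower_torus`**: `CovariantTowerParametrix.parametrix_l2_tower_torus_top` with the output-support
  hypothesis DISCHARGED and χ_out := Ω₀: for the k-fold tower operator Δ′ on every torus `UT N` (uniform block weights, top
  level on, every isometric transport), the b05 partition of unity at scale M₀ and ONE number ν with Σ_z Ω₀(z)(x) ≤ ν for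
  all x:  if q := ν·C_rem/M₀ < 1 then Δ′⁻¹ = G′₀(1 − R′)⁻¹ and ‖Δ′⁻¹‖_{ℓ²} ≤ ν·σ_k⁻¹·(1 − q)⁻¹.

WHAT IS NOT HERE (honest scope).  The COUNTING of ν (how many block hulls Ω₀(z) of (M₀ + 1)-balls meet a point on the
M₀-grid: ≤ (3 + 2B_k/M₀)^d-type, B_k the top averaging block's side) is the one hypothesis left — pure lattice combinatorics,
item for the next seat; no random-walk EXPANSION is written (resolvent form only); constants crude and k-DEPENDENT (σ_k); ℓ²
currency.  Row D4: RECORDS value; class of (T3)/NODE O.2 unchanged; D4 DISCHARGE NO DATE; NOT BetaPertH, NOT continuum,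
NOT Clay.
-/

namespace Summit.QuantumFields.BalabanUV.Beta.CovariantTowerLocality

open Finset
open Literature.MathematicalPhysics.QuantumFieldTheory.Balaban1983to89
open B9Thm37Sum B9Thm37Glue B9Thm37GluePU B9Thm37GlueTorusInv B9Thm37GlueTorusCov B9Thm37GlueTorusCovComp
open B9Thm37GlueTorusCovPoinc (tdepth_le card_block_le)
open B9Thm37GlueTorusCovLevels B9Thm37GlueTorusCovLevelsPoinc B9Thm37GlueTorusCovTower B9Thm37GlueTorusCovTowerDir
open B9Thm37GlueTorusCovTowerPU (towerK omegaBall omegaBall_zero_or_one omegaBall_eq_one omegaBall_const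
  towerLevelSum_comm_mulOp)
open Summit.QuantumFields.BalabanUV.Beta.CovariantTowerL2
open Summit.QuantumFields.BalabanUV.Beta.CovariantTowerRemainder
open Summit.QuantumFields.BalabanUV.Beta.CovariantTowerParametrix
open B5TorusCover (UT Ctr ctrU)
open B5SmoothPartition (hSU)
open B5Leibniz121 (up)

noncomputable section

/-! ## §1  The Leibniz parts of K(h) write only where ∂h lives -/

section Generic

variable {St Bd Cp : Type} [Fintype St] [DecidableEq St] [Fintype Bd] [Fintype Cp] [DecidableEq Cp]
  (src tgt : Bd → St) (c : Bd → ℝ) (Rm : Bd → Cp → Cp → ℝ)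

omit [Fintype St] [Fintype Cp] [DecidableEq Cp] in
/-- If χ = 1 at the starting point of every bond carrying ∂h ≠ 0, then M_χ∘(∂h·)ᵀ = (∂h·)ᵀ. [folklore] -/
theorem mulOp_comp_leibRemT_of_support (h χ : St → ℝ)
    (hχ : ∀ b, c b * (h (tgt b) - h (src b)) ≠ 0 → χ (src b) = 1) :
    mulOp (χ ∘ Prod.fst) ∘ₗ leibRemT (Cp := Cp) src tgt c h = leibRemT src tgt c h := by
  apply LinearMap.ext
  intro g
  funext p
  rw [LinearMap.comp_apply, mulOp_apply, Function.comp_apply, leibRemT_apply, Finset.mul_sum]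
  refine Finset.sum_congr rfl fun b _ => ?_
  split_ifs with hb
  · by_cases hz : c b * (h (tgt b) - h (src b)) = 0
    · rw [hz, zero_mul, mul_zero]
    · rw [← hb, hχ b hz, one_mul]
  · rw [zero_mul, mul_zero]

omit [Fintype St] [DecidableEq Cp] in
/-- If χ = 1 at BOTH ends of every bond carrying ∂h ≠ 0, then M_χ∘∇_U\*∘(∂h·) = ∇_U\*∘(∂h·). [folklore] -/
theorem mulOp_comp_covDT_leibRem_of_support (h χ : St → ℝ)
    (hχ : ∀ b, c b * (h (tgt b) - h (src b)) ≠ 0 → χ (src b) = 1 ∧ χ (tgt b) = 1) :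
    mulOp (χ ∘ Prod.fst) ∘ₗ (covDT src tgt c Rm ∘ₗ leibRem (Cp := Cp) src tgt c h) =
      covDT src tgt c Rm ∘ₗ leibRem src tgt c h := by
  apply LinearMap.ext
  intro f
  funext p
  rw [LinearMap.comp_apply, mulOp_apply, Function.comp_apply, LinearMap.comp_apply, covDT_apply, Finset.mul_sum]
  refine Finset.sum_congr rfl fun b _ => ?_
  by_cases hz : c b * (h (tgt b) - h (src b)) = 0
  · -- the bond carries no ∂h: both of its contributions vanish
    have hg : ∀ k, leibRem (Cp := Cp) src tgt c h f (b, k) = 0 := fun k => by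
      rw [leibRem_apply, hz, zero_mul]
    simp only [hg, mul_zero, Finset.sum_const_zero, sub_zero]
  · obtain ⟨hs, ht⟩ := hχ b hz
    by_cases h1 : tgt b = p.1
    · rw [← h1, ht, one_mul]
    · by_cases h2 : src b = p.1
      · rw [← h2, hs, one_mul]
      · rw [if_neg h1, if_neg h2, zero_mul, zero_mul, sub_zero, mul_zero]

end Generic

/-! ## §2  The torus: Ω₀(z)·K(h_z) = K(h_z) and the output support of the remainder terms -/

section Torus

variable {d : ℕ} {N : Fin d → ℕ} [∀ i, NeZero (N i)] [NeZero d]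

/-- **A bond along which h_z changes has both ends in Ω₀(z)** (`near_ctr_of_dh_ne`: both ends are within M₀ + 1 of the
centre; `omegaBall_eq_one`). [folklore] -/
theorem omegaBall_of_dh_ne {M : ℕ → ℕ} (hM : ∀ j, 1 ≤ M j) (hdiv : ∀ j i, M j ∣ N i) (k : ℕ) {M₀ : ℕ} (hM₀ : 1 ≤ M₀)
    (z : Ctr N M₀) (c : UT N × Fin d → ℝ) (b : UT N × Fin d)
    (hb : c b * (hSU N M₀ z (btgt b) - hSU N M₀ z (bsrc b)) ≠ 0) :
    omegaBall hM hdiv k M₀ z (bsrc b) = 1 ∧ omegaBall hM hdiv k M₀ z (btgt b) = 1 := by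
  obtain ⟨x, μ⟩ := b
  have hne : hSU N M₀ z (up x μ) ≠ hSU N M₀ z x := fun h0 => hb (by rw [btgt_apply, bsrc_apply, h0, sub_self, mul_zero])
  obtain ⟨h1, h2⟩ := near_ctr_of_dh_ne hM₀ z x μ hne
  exact ⟨omegaBall_eq_one hM hdiv k M₀ z h1, omegaBall_eq_one hM hdiv k M₀ z h2⟩

/-- Ω₀(z)·h_z = h_z (Ω₀(z) = 1 on the (M₀ + 1)-ball ⊃ supp h_z), as multiplication operators in either order. [folklore] -/
theorem mulOp_omegaBall_mul_mulOp_hSU {Cp : Type} {M : ℕ → ℕ} (hM : ∀ j, 1 ≤ M j) (hdiv : ∀ j i, M j ∣ N i) (k : ℕ)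
    {M₀ : ℕ} (hM₀ : 1 ≤ M₀) (z : Ctr N M₀) :
    (mulOp (omegaBall hM hdiv k M₀ z ∘ Prod.fst) * mulOp (hSU N M₀ z ∘ Prod.fst) : Module.End ℝ (UT N × Cp → ℝ)) =
      mulOp (hSU N M₀ z ∘ Prod.fst) := by
  apply LinearMap.ext
  intro f
  funext p
  simp only [Module.End.mul_apply, mulOp_apply, Function.comp_apply]
  rw [← mul_assoc, mul_comm (omegaBall hM hdiv k M₀ z p.1),
    hSU_mul_eq_of_one hM₀ z (fun _ hx => omegaBall_eq_one hM hdiv k M₀ z hx) p.1]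

/-- **Ω₀(z)·K(h_z) = K(h_z)** for pv21's concrete K(h) of the tower operator (uniform or general site weights W, every c,
every transport, every a): the Leibniz parts write only where ∂h_z lives (inside Ω₀(z), `omegaBall_of_dh_ne`), the
commutator part [M_{h_z}, level sum] writes only in supp h_z ∪ (level-blocks meeting supp h_z) ⊂ Ω₀(z) — in operator
form: M_Ω M_h = M_h and M_Ω L M_h = L M_Ω M_h (pv21 `towerLevelSum_comm_mulOp`, Ω₀(z) constant on level-k blocks).
[folklore] -/
theorem mulOp_omegaBall_mul_towerK {Cp : Type} [Fintype Cp] [DecidableEq Cp] {M : ℕ → ℕ} (hM : ∀ j, 1 ≤ M j)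
    (hdiv : ∀ j i, M j ∣ N i) (c : UT N × Fin d → ℝ) (Rm : UT N × Fin d → Cp → Cp → ℝ) (k : ℕ)
    (W : Fin (k + 1) → UT N → ℝ) (a : Fin (k + 1) → ℝ) {M₀ : ℕ} (hM₀ : 1 ≤ M₀) (z : Ctr N M₀) :
    mulOp (omegaBall hM hdiv k M₀ z ∘ Prod.fst) * towerK (torusTower hM hdiv) Rm c k W a (hSU N M₀ z) =
      towerK (torusTower hM hdiv) Rm c k W a (hSU N M₀ z) := by
  set Ω := omegaBall hM hdiv k M₀ z with hΩ
  set h := hSU N M₀ z with hh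
  set L := levelSum (fun l : Fin (k + 1) => towerBlk (torusTower hM hdiv) (l : ℕ)) W
    (fun l => towerTr (torusTower hM hdiv) Rm (l : ℕ)) a with hL
  have hsupp : ∀ b : UT N × Fin d, c b * (h (btgt b) - h (bsrc b)) ≠ 0 → Ω (bsrc b) = 1 ∧ Ω (btgt b) = 1 :=
    fun b hb => omegaBall_of_dh_ne hM hdiv k hM₀ z c b hb
  have e1 : mulOp (Ω ∘ Prod.fst) ∘ₗ leibRemT (Cp := Cp) bsrc btgt c h = leibRemT bsrc btgt c h :=
    mulOp_comp_leibRemT_of_support bsrc btgt c h Ω fun b hb => (hsupp b hb).1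
  have e2 : mulOp (Ω ∘ Prod.fst) ∘ₗ (covDT bsrc btgt c Rm ∘ₗ leibRem (Cp := Cp) bsrc btgt c h) =
      covDT bsrc btgt c Rm ∘ₗ leibRem bsrc btgt c h :=
    mulOp_comp_covDT_leibRem_of_support bsrc btgt c Rm h Ω hsupp
  have e3 : (mulOp (Ω ∘ Prod.fst) * mulOp (h ∘ Prod.fst) : Module.End ℝ (UT N × Cp → ℝ)) = mulOp (h ∘ Prod.fst) :=
    mulOp_omegaBall_mul_mulOp_hSU hM hdiv k hM₀ z
  have e4 : mulOp (Ω ∘ Prod.fst) * L = L * mulOp (Ω ∘ Prod.fst) :=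
    towerLevelSum_comm_mulOp (torusTower hM hdiv) Rm k W a fun x x' hx => omegaBall_const hM hdiv k M₀ z x x' hx
  -- assemble
  have t3 : mulOp (Ω ∘ Prod.fst) ∘ₗ (mulOp (h ∘ Prod.fst) * L) = mulOp (h ∘ Prod.fst) * L := by
    change mulOp (Ω ∘ Prod.fst) * (mulOp (h ∘ Prod.fst) * L) = _
    rw [← mul_assoc, e3]
  have t4 : mulOp (Ω ∘ Prod.fst) ∘ₗ (L * mulOp (h ∘ Prod.fst)) = L * mulOp (h ∘ Prod.fst) := by
    change mulOp (Ω ∘ Prod.fst) * (L * mulOp (h ∘ Prod.fst)) = _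
    rw [← mul_assoc, e4, mul_assoc, e3]
  have hmul : ∀ B : Module.End ℝ (UT N × Cp → ℝ), mulOp (Ω ∘ Prod.fst) * B = mulOp (Ω ∘ Prod.fst) ∘ₗ B :=
    fun _ => rfl
  unfold towerK
  rw [← hL, hmul, LinearMap.comp_add, LinearMap.comp_add, LinearMap.comp_neg, LinearMap.comp_sub,
    ← LinearMap.comp_assoc, e1, e2, t3, t4]

/-- **THE REMAINDER TERMS WRITE ONLY Ω₀(z)**: ((K(h_z)G′M_{h_z})v)(p) = 0 whenever Ω₀(z)(p₁) = 0, for ANY middle factor G′.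
[folklore] -/
theorem remainderTerm_support {Cp : Type} [Fintype Cp] [DecidableEq Cp] {M : ℕ → ℕ} (hM : ∀ j, 1 ≤ M j)
    (hdiv : ∀ j i, M j ∣ N i) (c : UT N × Fin d → ℝ) (Rm : UT N × Fin d → Cp → Cp → ℝ) (k : ℕ)
    (W : Fin (k + 1) → UT N → ℝ) (a : Fin (k + 1) → ℝ) {M₀ : ℕ} (hM₀ : 1 ≤ M₀) (z : Ctr N M₀)
    (G : Module.End ℝ (UT N × Cp → ℝ)) (v : UT N × Cp → ℝ) (p : UT N × Cp)
    (hp : omegaBall hM hdiv k M₀ z p.1 = 0) :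
    (towerK (torusTower hM hdiv) Rm c k W a (hSU N M₀ z) * G * mulOp (hSU N M₀ z ∘ Prod.fst) :
      Module.End ℝ (UT N × Cp → ℝ)) v p = 0 := by
  have e := mulOp_omegaBall_mul_towerK hM hdiv c Rm k W a hM₀ z
  have h1 : (towerK (torusTower hM hdiv) Rm c k W a (hSU N M₀ z) * G * mulOp (hSU N M₀ z ∘ Prod.fst) :
      Module.End ℝ (UT N × Cp → ℝ)) v p =
      (mulOp (omegaBall hM hdiv k M₀ z ∘ Prod.fst) *
        (towerK (torusTower hM hdiv) Rm c k W a (hSU N M₀ z) * G * mulOp (hSU N M₀ z ∘ Prod.fst)) :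
        Module.End ℝ (UT N × Cp → ℝ)) v p := by
    rw [← mul_assoc, ← mul_assoc, e]
  rw [h1, Module.End.mul_apply, mulOp_apply, Function.comp_apply, hp, zero_mul]

/-- The M₀-ball lies inside its block hull: `chiBall` ≤ Ω₀ pointwise. [folklore] -/
theorem chiBall_le_omegaBall {M : ℕ → ℕ} (hM : ∀ j, 1 ≤ M j) (hdiv : ∀ j i, M j ∣ N i) (k M₀ : ℕ) (z : Ctr N M₀)
    (x : UT N) : chiBall N M₀ z x ≤ omegaBall hM hdiv k M₀ z x := by
  unfold chiBall
  split_ifs with hx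
  · rw [omegaBall_eq_one hM hdiv k M₀ z hx]
  · rcases omegaBall_zero_or_one hM hdiv k M₀ z x with h | h
    · rw [h]
    · rw [h]; exact zero_le_one

/-! ## §3  Thm 3.7-shape in ℓ² for the tower with ONE counting number -/

/-- **THM 3.7-SHAPE IN ℓ² FOR THE k-FOLD COVARIANT TOWER OPERATOR ON THE TORUS, WITH ONE COUNTING NUMBER AS THE ONLY
HYPOTHESIS BEYOND THE DATA (MODEL).**  Δ′ = Δ_U + Σ_{l≤k} a_lG_lᵀG_l on `UT N` (cube-comb tower of sides M_j ∣ N_i; uniform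
block weights ω_l, a_l ≥ 0, top level on: a_k ≥ a_min > 0, |ω_k| ≥ w_min > 0; every isometric transport; c_min ≤ |c| ≤ c_max),
the b05 partition of unity h_z at scale M₀ (1 ≤ M₀, M₀ ∣ N_i, 2M₀ ≤ N_i), block hulls Ω₀(z), G′₀ = Σ_z h_zG′_zh_z,
R′ = Σ_z K(h_z)G′_zh_z.  If every point lies in at most ν of the regions Ω₀(z) (Σ_z Ω₀(z)(x) ≤ ν) and
q := (C_rem/M₀)·√(νν) < 1 (C_rem = `remConstTower`, i.e. M₀ > ν·C_rem; ν ≥ 0), then Δ′⁻¹ = G′₀∘(1 − R′)⁻¹ and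
‖Δ′⁻¹‖_{ℓ²} ≤ σ_k⁻¹·√(νν)·(1 − q)⁻¹ — for every torus and every transport. [folklore] -/
theorem parametrix_l2_tower_torus {Cp : Type} [Fintype Cp] [DecidableEq Cp] {M : ℕ → ℕ} (hM : ∀ j, 1 ≤ M j)
    (hdiv : ∀ j i, M j ∣ N i) (c : UT N × Fin d → ℝ) {cmin cmax : ℝ} (hcmin : 0 < cmin) (hc : ∀ b, cmin ≤ |c b|)
    (hc' : ∀ b, |c b| ≤ cmax) (Rm : UT N × Fin d → Cp → Cp → ℝ)
    (hRm : ∀ b i j, ∑ k, Rm b k i * Rm b k j = if i = j then (1 : ℝ) else 0) (k : ℕ) (ω : Fin (k + 1) → ℝ)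
    {wmax : ℝ} (hw' : ∀ l, |ω l| ≤ wmax) {a : Fin (k + 1) → ℝ} (ha : ∀ l, 0 ≤ a l) {amin wmin : ℝ}
    (hamin : 0 < amin) (hwmin : 0 < wmin) (hak : amin ≤ a (Fin.last k)) (hωk : wmin ≤ |ω (Fin.last k)|)
    {M₀ : ℕ} (hM₀ : 1 ≤ M₀) (hdiv₀ : ∀ i, M₀ ∣ N i) (h2N : ∀ i, 2 * M₀ ≤ N i) {ν : ℝ} (hν0 : 0 ≤ ν)
    (hcount : ∀ x : UT N, ∑ z : Ctr N M₀, omegaBall hM hdiv k M₀ z x ≤ ν)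
    (hlarge : remConstTower d M amin wmin cmin cmax wmax k a / M₀ * Real.sqrt (ν * ν) < 1) :
    Ring.inverse (towerOp (torusTower hM hdiv) Rm c k (fun l _ => ω l) a) =
        (∑ z : Ctr N M₀, mulOp (hSU N M₀ z ∘ Prod.fst) *
            dirInv (towerOp (torusTower hM hdiv) Rm c k (fun l _ => ω l) a) (omegaBall hM hdiv k M₀ z ∘ Prod.fst) *
            mulOp (hSU N M₀ z ∘ Prod.fst)) *
          Ring.inverse (1 - ∑ z : Ctr N M₀, towerK (torusTower hM hdiv) Rm c k (fun l _ => ω l) a (hSU N M₀ z) *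
            dirInv (towerOp (torusTower hM hdiv) Rm c k (fun l _ => ω l) a) (omegaBall hM hdiv k M₀ z ∘ Prod.fst) *
            mulOp (hSU N M₀ z ∘ Prod.fst)) ∧
      L2Bound (Ring.inverse (towerOp (torusTower hM hdiv) Rm c k (fun l _ => ω l) a))
        ((sigmaTowerTorus d M amin wmin cmin k)⁻¹ * Real.sqrt (ν * ν) *
          (1 - remConstTower d M amin wmin cmin cmax wmax k a / M₀ * Real.sqrt (ν * ν))⁻¹) := by
  have hcount₀ : ∀ p : UT N × Cp, ∑ z : Ctr N M₀, chiBall N M₀ z p.1 ≤ ν := fun p =>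
    (Finset.sum_le_sum fun z _ => chiBall_le_omegaBall hM hdiv k M₀ z p.1).trans (hcount p.1)
  exact parametrix_l2_tower_torus_top hM hdiv c hcmin hc hc' Rm hRm k ω hw' ha hamin hwmin hak hωk hM₀ hdiv₀ h2N
    hν0 hν0 hcount₀ (fun z p => omegaBall hM hdiv k M₀ z p.1) (fun z p => omegaBall_zero_or_one hM hdiv k M₀ z p.1)
    (fun p => hcount p.1)
    (fun z v p hp => remainderTerm_support hM hdiv c Rm k (fun l _ => ω l) a hM₀ z _ v p hp) hlarge

end Torus

end

end Summit.QuantumFields.BalabanUV.Beta.CovariantTowerLocality
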